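/-
Copyright (c) 2026. All rights reserved.
Released under Apache 2.0 license as described in the file LICENSE.
Authors: abc-iut cell — seat abc-iut-f-099 (block F fact-proving wave, tranche 99; FACT-LIST rows
F-0125 / F-0126 / F-0127).  Proof-only; no new definitions.
-/
import Literature.AnabelianGeometry.AbsoluteAnabelian.ParallelogramsPlanarFrames
import Literature.AnabelianGeometry.AbsoluteAnabelian.ParallelogramsLocalAddExists
import HarnessLib

/-!
# [AbsTopIII] Prop 2.5 (b)/(d)/(e): `Parallel`, `StrictlyCoOriented`, `LocalAdd` are RELATIONS —
# negative instances at the printed input data, universal closures REFUTED (proof-only)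

S. Mochizuki, *Topics in absolute anabelian geometry III*, Prop. 2.5 pp. 55–57 (bib key
`MochizukiAbsTopIII2015`).  The abc-iut cell's FACT-LIST rows F-0126 (`Parallelograms.Parallel`,
Prop 2.5 (b) p. 56), F-0127 (`Parallelograms.StrictlyCoOriented`, Prop 2.5 (d) p. 56) and F-0125
(`Parallelograms.LocalAdd`, Prop 2.5 (e) p. 57) name the three RELATIONS produced by the
"parallelograms, rectangles, squares" algorithm of Prop. 2.5 on an abstract pair `(U, 𝒬)`
(`HolomorphicCores.lean`): parallelism of line segments, strict co-orientation of frames, and the local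
additive structure `a +_p b = c`.  They are vocabulary (predicates with parameters), exactly like their
`Is*`-named siblings of the same file; a relation has no truth value "as a fact".  This file records the
kernel events that classify the three rows (cell rule R5: a parametrised row is admissible AT NAMED
INSTANCES only):

* NEGATIVE INSTANCES AT THE PRINTED INPUT DATA (`U ⊆ ℂ` open, any collection `𝒮(U) ⊆ 𝒬 ⊆ 𝒫(U)`,
  in particular `𝒬 = 𝒮(U)`): two perpendicular edges of a square are NOT parallel
  (`Parallelograms.not_parallel_perpendicular`); a corner frame is NOT strictly co-oriented with any
  frame whose first side is an edge of the first frame's parallelogram — e.g. with its own transpose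
  (`Parallelograms.not_strictlyCoOriented_of_fst_edge`); `a +_p b = c` FAILS whenever
  `c ≠ a + b − p`, and whenever `a − p`, `b − p` are `ℝ`-dependent
  (`Parallelograms.not_localAdd_of_ne`, `Parallelograms.not_localAdd_of_not_linearIndependent`).
* DEPENDENCE ON `𝒬`: for the empty collection there are no line segments at all, so `Parallel ∅` and
  `StrictlyCoOriented ∅` are empty relations and `LocalAdd ∅` is the trivial part of (e)
  (`Parallelograms.not_isLineSegment_empty`, `…not_parallel_empty`, `…not_strictlyCoOriented_empty`,
  `…localAdd_empty_iff`).
* UNIVERSAL CLOSURES REFUTED (the rows' "schema" reading): `Parallelograms.not_forall_parallel`,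
  `Parallelograms.not_forall_strictlyCoOriented`, `Parallelograms.not_forall_localAdd`, each witnessed
  at the printed model `(ℂ, 𝒮(ℂ))`, not at a junk instance.

The POSITIVE instance forms — the content of Prop. 2.5 at the printed input data — are already theorems
of the tree and are only cited here: `Parallelograms.parallel_opposite_edges` /
`Parallelograms.Parallel.exists_sub_eq_mul` ((b): opposite edges are parallel; parallel segments have
proportional directions), `Parallelograms.strictlyCoOriented_of_pos_coeffs` /
`Parallelograms.StrictlyCoOriented.det_pos_iff` and `twoOrientations_holds` ((d): precisely two
orientations), `Parallelograms.localAdd_of_linearIndependent` / `Parallelograms.coe_eq_of_localAdd` /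
`Parallelograms.exists_nhds_localAdd_iff` ((e): `a +_p b = a + b − p` near `p`).  A refuted universal
closure says the row is a relation on data, not that anything in print is false; refereed pre-IUT
material; nothing here bears on the disputed [IUTchIII] Cor. 3.12.
-/

namespace Literature.AnabelianGeometry.AbsoluteAnabelian

open _root_.Complex _root_.Set

noncomputable section

namespace Parallelograms

/-! ### Dependence on `𝒬`: the empty collection has no line segments -/

section Empty

variable {U : Type*}

/-- For the empty collection `𝒬 = ∅` there are no strict line segments (a strict line segment is cut
out by two members of `𝒬`). [cite: MochizukiAbsTopIII2015, Proposition 2.5 (a) p.56] -/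
theorem not_isStrictLineSegment_empty (L : Set U) : ¬ IsStrictLineSegment (∅ : Set (Set U)) L := by
  rintro ⟨Q₁, hQ₁, -⟩
  exact hQ₁

/-- For `𝒬 = ∅` there are no line segments (a strict chain has length `≥ 2`, hence a member, which
would be a strict line segment). [cite: MochizukiAbsTopIII2015, Proposition 2.5 (a) p.56] -/
theorem not_isLineSegment_empty (L : Set U) : ¬ IsLineSegment (∅ : Set (Set U)) L := by
  rintro ⟨c, ⟨hlen, hmem, -⟩, -⟩
  obtain ⟨M, hM⟩ := List.exists_mem_of_length_pos (by omega : 0 < c.length)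
  exact not_isStrictLineSegment_empty M (hmem M hM)

/-- For `𝒬 = ∅` no two subsets are parallel: `Parallel ∅` is the empty relation (parallel sets are line
segments by definition). [cite: MochizukiAbsTopIII2015, Proposition 2.5 (b) p.56] -/
theorem not_parallel_empty (L L' : Set U) : ¬ Parallel (∅ : Set (Set U)) L L' :=
  fun h => not_isLineSegment_empty L h.1

/-- For `𝒬 = ∅` no two frames are strictly co-oriented: `StrictlyCoOriented ∅` is the empty relation
(a framed set is a line segment by definition). [cite: MochizukiAbsTopIII2015, Proposition 2.5 (d) p.56] -/
theorem not_strictlyCoOriented_empty (P : Set U) (F : Set U × Set U) (P' : Set U)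
    (F' : Set U × Set U) : ¬ StrictlyCoOriented (∅ : Set (Set U)) P F P' F' :=
  fun h => not_isLineSegment_empty F'.1 h.1.1

/-- For `𝒬 = ∅` the algorithm recovers no parallelograms (a pre-∂-parallelogram consists of line
segments). [cite: MochizukiAbsTopIII2015, Proposition 2.5 (c) p.56] -/
theorem parallelograms_empty : parallelograms (∅ : Set (Set U)) = ∅ := by
  ext P
  simp only [parallelograms, mem_setOf_eq, mem_empty_iff_false, iff_false]
  rintro ⟨L, ⟨hL, -⟩, -⟩
  exact not_isLineSegment_empty (L 0) (hL 0)

/-- For `𝒬 = ∅` the local additive structure is its trivial part: `a +_p b = c` iff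
(`a = p` and `c = b`) or (`b = p` and `c = a`) — the third clause of (e) needs a recovered parallelogram,
of which there is none. [cite: MochizukiAbsTopIII2015, Proposition 2.5 (e) p.57] -/
theorem localAdd_empty_iff (p a b c : U) :
    LocalAdd (∅ : Set (Set U)) p a b c ↔ (a = p ∧ c = b) ∨ (b = p ∧ c = a) := by
  refine ⟨fun h => ?_, fun h => h.elim Or.inl (fun h => Or.inr (Or.inl h))⟩
  rcases h with h | h | ⟨-, -, P, hP, -⟩
  · exact Or.inl h
  · exact Or.inr h
  · rw [parallelograms_empty] at hP
    exact hP.elim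

end Empty

/-! ### Negative instances at the printed input data `U ⊆ ℂ`, `𝒮(U) ⊆ 𝒬 ⊆ 𝒫(U)` -/

section Planar

variable {U : Set ℂ}

/-- **Prop 2.5 (b), a non-instance**: for `U ⊆ ℂ` open and `𝒮(U) ⊆ 𝒬 ⊆ 𝒫(U)`, two PERPENDICULAR
segments `[z, z + v]`, `[z, z + i v]` (`v ≠ 0`) lying in `U` are NOT parallel line segments of `(U, 𝒬)`
— parallel segments have real-proportional directions (`Parallel.exists_sub_eq_mul`), and `i v` is not
a real multiple of `v`. [cite: MochizukiAbsTopIII2015, Proposition 2.5 (b) p.56] -/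
theorem not_parallel_perpendicular (hU : IsOpen U) {𝒬 : Set (Set U)}
    (h𝒬 : ∀ Q ∈ 𝒬, Subtype.val '' Q ∈ parallelogramsIn U)
    (h𝒮 : ∀ Q : Set U, Subtype.val '' Q ∈ squaresIn U → Q ∈ 𝒬) {z v : ℂ} (hv : v ≠ 0)
    (hL : segment ℝ z (z + v) ⊆ U) (hL' : segment ℝ z (z + I * v) ⊆ U) :
    ¬ Parallel 𝒬 (Subtype.val ⁻¹' segment ℝ z (z + v)) (Subtype.val ⁻¹' segment ℝ z (z + I * v)) := by
  intro h
  have hzv : z ≠ z + v := fun h' => hv (by linear_combination -h')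
  have himL : Subtype.val '' (Subtype.val ⁻¹' segment ℝ z (z + v) : Set U) = segment ℝ z (z + v) := by
    rw [image_preimage_eq_inter_range, Subtype.range_coe, inter_eq_left.2 hL]
  have himL' : Subtype.val '' (Subtype.val ⁻¹' segment ℝ z (z + I * v) : Set U) =
      segment ℝ z (z + I * v) := by
    rw [image_preimage_eq_inter_range, Subtype.range_coe, inter_eq_left.2 hL']
  obtain ⟨r, hr⟩ := h.exists_sub_eq_mul hU h𝒬 h𝒮 hzv himL himL'
  have hr' : (I - r) * v = 0 := by linear_combination hr
  rcases mul_eq_zero.1 hr' with h0 | h0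
  · have := congrArg Complex.im h0
    simp at this
  · exact hv h0

/-- **Prop 2.5 (d), a non-instance**: a corner frame with parallelogram `P = p + (0,1) e₁ + (0,1) e₂`
(`e₁, e₂` independent) is NOT strictly co-oriented with any frame `F'` whose first side is the edge
`[p, p + e₂]` of `P` — e.g. with the transposed frame `(S₂, S₁)` of `P` itself, which represents the
opposite orientation: "`S₁'` framed by `F`" asks the edge to meet the OPEN parallelogram in infinitely
many points, and it does not meet it at all. [cite: MochizukiAbsTopIII2015, Proposition 2.5 (d) p.56] -/
theorem not_strictlyCoOriented_of_fst_edge (𝒬 : Set (Set U)) {p e₁ e₂ : ℂ}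
    (he : LinearIndependent ℝ ![e₁, e₂]) (F : Set U × Set U) (P' S' : Set U) :
    ¬ StrictlyCoOriented 𝒬 (Subtype.val ⁻¹' openParallelogram p e₁ e₂) F P'
      (Subtype.val ⁻¹' segment ℝ p (p + e₂), S') := by
  rintro ⟨⟨-, hinf⟩, -⟩
  have hne : (segment ℝ p (p + e₂) ∩ openParallelogram p e₁ e₂).Nonempty := by
    obtain ⟨x, hx⟩ := hinf.nonempty
    exact ⟨x, hx⟩
  obtain ⟨α, β, hα, -, hαβ⟩ := exists_pos_coeffs_of_segment_meets he hne
  have := (LinearIndependent.pair_iff.1 he) α (β - 1) (by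
    rw [Complex.real_smul, Complex.real_smul]; push_cast; linear_combination -hαβ)
  linarith [this.1]

/-- **Prop 2.5 (e), a non-instance**: for `U ⊆ ℂ` open, `𝒮(U) ⊆ 𝒬 ⊆ 𝒫(U)`, `a, b ≠ p`: if
`c ≠ a + b − p` then `a +_p b = c` does NOT hold — the local additive structure IS the parallelogram law
(`coe_eq_of_localAdd`, with the Prop 2.5 (c) reconstruction `parallelograms 𝒬 = 𝒫(U)` now a theorem,
`parallelograms_eq_of_subset`). [cite: MochizukiAbsTopIII2015, Proposition 2.5 (e) p.57] -/
theorem not_localAdd_of_ne (hU : IsOpen U) {𝒬 : Set (Set U)}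
    (h𝒬 : ∀ Q ∈ 𝒬, Subtype.val '' Q ∈ parallelogramsIn U)
    (h𝒮 : ∀ Q : Set U, Subtype.val '' Q ∈ squaresIn U → Q ∈ 𝒬) {p a b c : U} (ha : a ≠ p)
    (hb : b ≠ p) (hc : (c : ℂ) ≠ a + b - p) : ¬ LocalAdd 𝒬 p a b c :=
  fun h => hc (coe_eq_of_localAdd hU h𝒬 h𝒮 (parallelograms_eq_of_subset hU h𝒬 h𝒮) ha hb h).1

/-- **Prop 2.5 (e), a non-instance**: for `U ⊆ ℂ` open, `𝒮(U) ⊆ 𝒬 ⊆ 𝒫(U)`, `a, b ≠ p` with `a − p`,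
`b − p` real-DEPENDENT (collinear with `p`), `a +_p b = c` holds for NO `c`: the sum is "defined for
`a, b` in some neighborhood of `p`" in general position only.
[cite: MochizukiAbsTopIII2015, Proposition 2.5 (e) p.57] -/
theorem not_localAdd_of_not_linearIndependent (hU : IsOpen U) {𝒬 : Set (Set U)}
    (h𝒬 : ∀ Q ∈ 𝒬, Subtype.val '' Q ∈ parallelogramsIn U)
    (h𝒮 : ∀ Q : Set U, Subtype.val '' Q ∈ squaresIn U → Q ∈ 𝒬) {p a b : U} (ha : a ≠ p)
    (hb : b ≠ p) (hdep : ¬ LinearIndependent ℝ ![(a : ℂ) - p, (b : ℂ) - p]) (c : U) :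
    ¬ LocalAdd 𝒬 p a b c :=
  fun h => hdep (coe_eq_of_localAdd hU h𝒬 h𝒮 (parallelograms_eq_of_subset hU h𝒬 h𝒮) ha hb h).2

end Planar

/-! ### The universal closures of the three rows are false (witnessed at the model `(ℂ, 𝒮(ℂ))`) -/

section Closure

/-- The printed input data on the whole plane: `U = ℂ`, `𝒬 = 𝒮(ℂ)` (all squares), as a collection of
subsets of the subtype `↥(univ : Set ℂ)`. (Auxiliary abbreviation-free statement helper.)
[cite: MochizukiAbsTopIII2015, Proposition 2.5 p.55] -/
theorem squares_hyps :
    (∀ Q ∈ {Q : Set (univ : Set ℂ) | Subtype.val '' Q ∈ squaresIn univ},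
        Subtype.val '' Q ∈ parallelogramsIn (univ : Set ℂ)) ∧
      ∀ Q : Set (univ : Set ℂ), Subtype.val '' Q ∈ squaresIn univ →
        Q ∈ {Q : Set (univ : Set ℂ) | Subtype.val '' Q ∈ squaresIn univ} :=
  ⟨fun _ hQ => squaresIn_subset_parallelogramsIn _ hQ, fun _ h => h⟩

/-- **F-0126: the universal closure of `Parallelograms.Parallel` is FALSE** — witnessed at the printed
input data `(ℂ, 𝒮(ℂ))` by the perpendicular unit segments `[0, 1]`, `[0, i]`.  The row is a relation
(Prop 2.5 (b)), admissible at named instances only; positive instances: `parallel_opposite_edges`.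
[cite: MochizukiAbsTopIII2015, Proposition 2.5 (b) p.56] -/
theorem not_forall_parallel :
    ¬ ∀ (U : Type) (𝒬 : Set (Set U)) (L L' : Set U),
        Literature.AnabelianGeometry.AbsoluteAnabelian.Parallelograms.Parallel 𝒬 L L' := by
  intro h
  have h1 := not_parallel_perpendicular (U := (univ : Set ℂ)) isOpen_univ squares_hyps.1 squares_hyps.2
    (z := 0) (v := 1) one_ne_zero (subset_univ _) (subset_univ _)
  exact h1 (h _ _ _ _)

/-- **F-0127: the universal closure of `Parallelograms.StrictlyCoOriented` is FALSE** — witnessed at the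
printed input data `(ℂ, 𝒮(ℂ))` by the unit-square corner frame `([0,1], [0,i])` at `0` and its
transpose `([0,i], [0,1])` (opposite orientations).  The row is a relation (Prop 2.5 (d)), admissible at
named instances only; positive instances: `strictlyCoOriented_of_pos_coeffs`, and the count of
orientations `twoOrientations_holds`. [cite: MochizukiAbsTopIII2015, Proposition 2.5 (d) p.56] -/
theorem not_forall_strictlyCoOriented :
    ¬ ∀ (U : Type) (𝒬 : Set (Set U)) (P : Set U) (F : Set U × Set U) (P' : Set U)
        (F' : Set U × Set U),
        Literature.AnabelianGeometry.AbsoluteAnabelian.Parallelograms.StrictlyCoOriented 𝒬 P F P' F' := by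
  intro h
  have h1 := not_strictlyCoOriented_of_fst_edge (U := (univ : Set ℂ))
    {Q : Set (univ : Set ℂ) | Subtype.val '' Q ∈ squaresIn univ} (p := 0) (e₁ := 1) (e₂ := I)
    (by simpa using linearIndependent_pair_mul_I (v := (1 : ℂ)) one_ne_zero)
    (Subtype.val ⁻¹' segment ℝ (0 : ℂ) (0 + 1), Subtype.val ⁻¹' segment ℝ (0 : ℂ) (0 + I))
    (Subtype.val ⁻¹' openParallelogram 0 I 1) (Subtype.val ⁻¹' segment ℝ (0 : ℂ) (0 + 1))
  exact h1 (h _ _ _ _ _ _)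

/-- **F-0125: the universal closure of `Parallelograms.LocalAdd` is FALSE** — witnessed at the printed
input data `(ℂ, 𝒮(ℂ))` by `p = 0`, `a = 1`, `b = i`, `c = 0 ≠ 1 + i`.  The row is a relation
(Prop 2.5 (e)), admissible at named instances only; positive instances: `localAdd_of_linearIndependent`,
`exists_nhds_localAdd_iff`. [cite: MochizukiAbsTopIII2015, Proposition 2.5 (e) p.57] -/
theorem not_forall_localAdd :
    ¬ ∀ (U : Type) (𝒬 : Set (Set U)) (p a b c : U),
        Literature.AnabelianGeometry.AbsoluteAnabelian.Parallelograms.LocalAdd 𝒬 p a b c := by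
  intro h
  have h1 := not_localAdd_of_ne (U := (univ : Set ℂ)) isOpen_univ squares_hyps.1 squares_hyps.2
    (p := ⟨0, mem_univ _⟩) (a := ⟨1, mem_univ _⟩) (b := ⟨I, mem_univ _⟩) (c := ⟨0, mem_univ _⟩)
    (fun h' => one_ne_zero (congrArg Subtype.val h'))
    (fun h' => I_ne_zero (congrArg Subtype.val h'))
    (by
      intro h'
      have := congrArg Complex.re h'
      simp at this)
  exact h1 (h _ _ _ _ _ _)

end Closure

end Parallelograms

end

end Literature.AnabelianGeometry.AbsoluteAnabelian
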